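import Summits.BirchSwinnertonDyer.BirchSwinnertonDyer.Theorems.TameQuarticSolventSolventPairLowerBoundStubGoodReduction
import Literature.NumberTheory.QuadraticFields.SquareRootGenerator
import Literature.NumberTheory.EllipticCurves.QuadraticTwist
import Mathlib.Algebra.QuadraticAlgebra.Basic
import Mathlib.NumberTheory.RamificationInertia.Valuation
import Mathlib.RingTheory.RamificationInertia.Ramification
import Mathlib.RingTheory.Flat.TorsionFree
import HarnessLib

/-!
# Route `TameQuarticSolvent`, crux `SolventPairLowerBound` (stmt-BirchSwinnertonDyer-21391), line `birth` —
# glue «SolventField»: the tame quartic solvent field `L″ = ℚ(√d)(√β)` has ramification index `4` at every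
# place above `3`, so a (t′)-at-`3` curve acquires good reduction there

HONEST FRAMING. Theorems only; helper file (`--supports stmt-BirchSwinnertonDyer-21391`). Nothing here is
progress on the open stubs `stub_twistDatum` / `stub_pairGivenGoodField` beyond FIELD-THEORETIC bookkeeping:
the number fields the line works over are produced in the exact currency of the landed lever
`Theorems.SolventPairLowerBound.stub_goodReduction` (`w.asIdeal.ramificationIdx ℤ = 4`) and of the
Artin–Milne bookkeeping `Literature.NumberTheory.EllipticCurves.padicValRat_shaAn_add_le_shaOrder_of_bsdpOver`
(`Module.finrank ℚ K = 2`, twist by `NumberField.discr K`, `Module.finrank K M = 2`, `θ² = β`, `θ ∉ K`).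
BSD is not proved by any of this; no route file is imported.
-/

-- D-0017: single-problem summit, so `Summit.BirchSwinnertonDyer.BirchSwinnertonDyer.…` repeats a namespace BY DESIGN.
set_option linter.dupNamespace false

noncomputable section

open scoped NumberField

open IsDedekindDomain IsDedekindDomain.HeightOneSpectrum NumberField WithZero
  Literature.NumberTheory.EllipticCurves.Rank1Residual Summit.BirchSwinnertonDyer.Rank1Residual.Additive

namespace Summit.BirchSwinnertonDyer.BirchSwinnertonDyer.Theorems.SolventPairLowerBound

/-! ## Ramification in a relative quadratic extension `M = K(√β)` -/

section RelQuadratic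

variable {K M : Type} [Field K] [NumberField K] [Field M] [NumberField M] [Algebra K M]

/-- **A square root of an element of odd valuation ramifies.** Let `M/K` be number fields with
`[M : K] = 2`, `θ ∈ M` with `θ² = β ∈ K`, and `v` a finite place of `K` at which `β` has ODD valuation
`ord_v β = -(2k+1)`… precisely `v(β) = exp(2k+1)`. Then every place `w` of `M` above `v` has ramification
index `e(w|v) = 2`: `e(w|v) · (2k+1) = 2 · ord_w θ` forces `e(w|v)` even, and `0 < e(w|v) ≤ [M : K] = 2`
(Mathlib `IsDedekindDomain.HeightOneSpectrum.valuation_liesOver`, `Ideal.ramificationIdx_le_finrank`).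
[folklore] -/
theorem ramificationIdx_eq_two_of_sq_eq_of_valuation_eq (h2 : Module.finrank K M = 2) {β : K} {θ : M}
    (hθ : θ ^ 2 = algebraMap K M β) (v : HeightOneSpectrum (𝓞 K)) {k : ℤ}
    (hβ : v.valuation K β = exp (2 * k + 1)) (w : HeightOneSpectrum (𝓞 M))
    [w.asIdeal.LiesOver v.asIdeal] : w.asIdeal.ramificationIdx (𝓞 K) = 2 := by
  haveI := w.isPrime
  haveI := v.isMaximal
  haveI : NoZeroSMulDivisors (𝓞 K) (𝓞 M) := ⟨fun h ↦ by
    by_contra hh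
    push Not at hh
    exact hh.2 ((smul_eq_zero_iff_right hh.1).mp h)⟩
  set e := v.asIdeal.ramificationIdx' w.asIdeal with he
  have hval : v.valuation K β ^ e = w.valuation M θ ^ 2 := by
    rw [← map_pow (w.valuation M) θ 2, hθ, ← valuation_liesOver M v w]
  have hβ0 : β ≠ 0 := by
    intro h; rw [h, map_zero] at hβ; exact exp_ne_zero hβ.symm
  have hθ0 : θ ≠ 0 := by
    intro h
    rw [h, zero_pow two_ne_zero, eq_comm, map_eq_zero] at hθ
    exact hβ0 hθ
  have hwθ : w.valuation M θ ≠ 0 := (Valuation.ne_zero_iff _).mpr hθ0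
  obtain ⟨z, hz⟩ : ∃ z : ℤ, w.valuation M θ = exp z := ⟨_, (exp_log hwθ).symm⟩
  rw [hβ, hz, ← exp_nsmul, ← exp_nsmul, exp_inj] at hval
  simp only [nsmul_eq_mul] at hval
  have he0 : e ≠ 0 :=
    Ideal.IsDedekindDomain.ramificationIdx'_ne_zero_of_liesOver w.asIdeal v.ne_bot
  have hle : e ≤ 2 := h2 ▸ Ideal.ramificationIdx_le_finrank (𝓞 M) K M w.asIdeal
  have he2 : e = 2 := by
    rcases Nat.lt_or_ge e 2 with h | h
    · interval_cases e
      · exact absurd rfl he0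
      · exfalso; simp only [Nat.cast_one] at hval; omega
    · omega
  rw [← Ideal.ramificationIdx'_eq_ramificationIdx v.asIdeal w.asIdeal v.ne_bot, ← he, he2]

/-- **Ramification index over `ℤ` in the tower `ℚ ⊂ K ⊂ M = K(√β)`.** Let `[M : K] = 2`, `θ² = β`,
`p` a prime such that every place `v ∋ p` of `K` has `e(v|p) = e₀` and `β` of odd `v`-valuation. Then
every place `w ∋ p` of `M` has `e(w|p) = e₀ · 2` (multiplicativity of ramification indices in towers,
Mathlib `Ideal.ramificationIdx_tower`, and the previous lemma at `v = w ∩ K`). [folklore] -/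
theorem ramificationIdx_int_eq_of_sq_eq (p : ℕ) [hp : Fact p.Prime] (h2 : Module.finrank K M = 2)
    {β : K} {θ : M} (hθ : θ ^ 2 = algebraMap K M β) {e₀ : ℕ}
    (hK : ∀ v : HeightOneSpectrum (𝓞 K), (p : 𝓞 K) ∈ v.asIdeal →
      v.asIdeal.ramificationIdx ℤ = e₀ ∧ ∃ k : ℤ, v.valuation K β = exp (2 * k + 1))
    (w : HeightOneSpectrum (𝓞 M)) (hw : (p : 𝓞 M) ∈ w.asIdeal) :
    w.asIdeal.ramificationIdx ℤ = e₀ * 2 := by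
  haveI := w.isPrime
  -- the place of `K` below `w`
  have hpK : (p : 𝓞 K) ∈ w.asIdeal.under (𝓞 K) := by
    rw [Ideal.under_def, Ideal.mem_comap, map_natCast]; exact hw
  have hne : w.asIdeal.under (𝓞 K) ≠ ⊥ := by
    intro h
    rw [h, Ideal.mem_bot] at hpK
    exact (NeZero.ne (p : 𝓞 K)) hpK
  let v : HeightOneSpectrum (𝓞 K) := ⟨w.asIdeal.under (𝓞 K), inferInstance, hne⟩
  haveI hlies : w.asIdeal.LiesOver v.asIdeal := ⟨rfl⟩
  obtain ⟨he₀, k, hk⟩ := hK v hpK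
  haveI : Module.IsTorsionFree (𝓞 K) (𝓞 M) := inferInstance
  rw [Ideal.ramificationIdx_tower v.asIdeal w.asIdeal, he₀,
    ramificationIdx_eq_two_of_sq_eq_of_valuation_eq h2 hθ v hk w]

end RelQuadratic

/-! ## The quadratic field `K = ℚ(√d)` with `ord_p d = 1`: `p` ramifies, `ord_v √d = 1` -/

section Quadratic

variable {K : Type} [Field K] [NumberField K]

/-- **`p` ramifies in `ℚ(√d)` when `ord_p d = 1`, and `√d` is a uniformiser above `p`.** Let
`[K : ℚ] = 2`, `θ₁ ∈ K` with `θ₁² = d ∈ ℤ`, `ord_p d = 1`. Then every place `v ∋ p` of `K` has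
`e(v|p) = 2` and `v(θ₁) = exp(−1)`: `e(v|p) · ord_p d = ord_v d = 2 ord_v θ₁` forces `e(v|p)` even, and
`0 < e(v|p) ≤ [K : ℚ] = 2`. [folklore] -/
theorem ramificationIdx_eq_two_of_sq_eq_intCast (p : ℕ) [hp : Fact p.Prime]
    (h2 : Module.finrank ℚ K = 2) {d : ℤ} {θ₁ : K} (hθ₁ : θ₁ ^ 2 = (d : K))
    (hd : padicValInt p d = 1) (v : HeightOneSpectrum (𝓞 K)) (hv : (p : 𝓞 K) ∈ v.asIdeal) :
    v.asIdeal.ramificationIdx ℤ = 2 ∧ v.valuation K θ₁ = exp (-1 : ℤ) := by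
  classical
  haveI := v.isPrime
  -- the place of `ℤ` below `v` is `(p)`
  set u : HeightOneSpectrum ℤ := (Rat.HeightOneSpectrum.primesEquiv (R := ℤ)).symm ⟨p, hp.out⟩
    with hudef
  have hu : Rat.HeightOneSpectrum.natGenerator u = p :=
    congrArg Subtype.val ((Rat.HeightOneSpectrum.primesEquiv (R := ℤ)).apply_symm_apply ⟨p, hp.out⟩)
  have huspan : u.asIdeal = Ideal.span {(p : ℤ)} := by
    rw [Rat.HeightOneSpectrum.asIdeal_eq_span_natGenerator_int, hu]
  haveI hlies' : v.asIdeal.LiesOver (Ideal.span {(p : ℤ)}) := liesOver_span_of_natCast_mem p K v hv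
  haveI hlies : v.asIdeal.LiesOver u.asIdeal := by rw [huspan]; exact hlies'
  have hd0 : d ≠ 0 := by rintro rfl; simp at hd
  have hdq : (d : ℚ) ≠ 0 := by exact_mod_cast hd0
  set e := u.asIdeal.ramificationIdx' v.asIdeal with he
  -- `ord_v d = e · ord_p d = e`, and `ord_v d = 2 ord_v θ₁`
  have hval : u.valuation ℚ (d : ℚ) ^ e = v.valuation K θ₁ ^ 2 := by
    rw [← map_pow (v.valuation K) θ₁ 2, hθ₁, valuation_liesOver (K := ℚ) K u v (d : ℚ), map_intCast]
  rw [Rat.HeightOneSpectrum.valuation_eq_exp_neg_padicValRat u hdq, hu, padicValRat.of_int, hd]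
    at hval
  have hθ0 : θ₁ ≠ 0 := by
    intro h; rw [h, zero_pow two_ne_zero, eq_comm, Int.cast_eq_zero] at hθ₁; exact hd0 hθ₁
  have hvθ : v.valuation K θ₁ ≠ 0 := (Valuation.ne_zero_iff _).mpr hθ0
  obtain ⟨z, hz⟩ : ∃ z : ℤ, v.valuation K θ₁ = exp z := ⟨_, (exp_log hvθ).symm⟩
  rw [hz, ← exp_nsmul, ← exp_nsmul, exp_inj] at hval
  simp only [nsmul_eq_mul, Nat.cast_one, mul_neg, mul_one] at hval
  have he0 : e ≠ 0 :=
    Ideal.IsDedekindDomain.ramificationIdx'_ne_zero_of_liesOver v.asIdeal u.ne_bot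
  have hle : e ≤ 2 := h2 ▸ Ideal.ramificationIdx_le_finrank (𝓞 K) ℚ K v.asIdeal
  have he2 : e = 2 := by
    rcases Nat.lt_or_ge e 2 with h | h
    · interval_cases e
      · exact absurd rfl he0
      · exfalso; simp only [Nat.cast_one] at hval; omega
    · omega
  refine ⟨?_, ?_⟩
  · rw [← Ideal.ramificationIdx'_eq_ramificationIdx u.asIdeal v.asIdeal u.ne_bot, ← he, he2]
  · rw [hz]
    congr 1
    rw [he2] at hval
    push_cast at hval
    omega

/-- `ord_p d = 1` makes `d` a non-square in `ℚ` (`ord_p` of a square is even). [folklore] -/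
theorem not_isSquare_ratCast_of_padicValInt_eq_one (p : ℕ) [hp : Fact p.Prime] {d : ℤ}
    (hd : padicValInt p d = 1) : ¬ IsSquare (d : ℚ) := by
  rintro ⟨r, hr⟩
  have hd0 : d ≠ 0 := by rintro rfl; simp at hd
  have hr0 : r ≠ 0 := by
    rintro rfl; rw [mul_zero] at hr; exact hd0 (by exact_mod_cast hr)
  have h := congrArg (padicValRat p) hr
  rw [padicValRat.of_int, hd, padicValRat.mul hr0 hr0] at h
  omega

/-- An element with ODD valuation at some finite place is not a square. [folklore] -/
theorem not_isSquare_of_valuation_eq_exp (v : HeightOneSpectrum (𝓞 K)) {β : K} {k : ℤ}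
    (hβ : v.valuation K β = exp (2 * k + 1)) : ¬ IsSquare β := by
  rintro ⟨γ, hγ⟩
  have hβ0 : β ≠ 0 := by
    intro h; rw [h, map_zero] at hβ; exact exp_ne_zero hβ.symm
  have hγ0 : γ ≠ 0 := by rintro rfl; rw [mul_zero] at hγ; exact hβ0 hγ
  have hvγ : v.valuation K γ ≠ 0 := (Valuation.ne_zero_iff _).mpr hγ0
  obtain ⟨z, hz⟩ : ∃ z : ℤ, v.valuation K γ = exp z := ⟨_, (exp_log hvγ).symm⟩
  rw [hγ, map_mul, hz, ← exp_add, exp_inj] at hβ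
  omega

/-- **The real quadratic field `ℚ(√d)` as a number field.** For `d ∈ ℤ` not a rational square there is
a number field `K` of degree `2` with a square-root generator `θ₁`, `θ₁² = d`, `θ₁ ∉ ℚ` (Mathlib's
`QuadraticAlgebra ℚ d 0`, a field since `X² − d` has no rational root). [folklore] -/
theorem exists_quadraticField_sq_eq_intCast {d : ℤ} (hd : ¬ IsSquare (d : ℚ)) :
    ∃ (K : Type) (_ : Field K) (_ : NumberField K) (θ₁ : K),
      Module.finrank ℚ K = 2 ∧ θ₁ ^ 2 = (d : K) ∧ θ₁ ∉ Set.range (algebraMap ℚ K) := by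
  have hns : ∀ r : ℚ, r ^ 2 ≠ (d : ℚ) := fun r hr ↦ hd ⟨r, by rw [← hr, sq]⟩
  haveI : Fact (∀ r : ℚ, r ^ 2 ≠ (d : ℚ) + 0 * r) := ⟨fun r h ↦ hns r (by rw [h]; ring)⟩
  let L := QuadraticAlgebra ℚ (d : ℚ) 0
  haveI : NumberField L := NumberField.of_module_finite ℚ L
  have h2L : Module.finrank ℚ L = 2 := by convert QuadraticAlgebra.finrank_eq_two (d : ℚ) (0 : ℚ)
  have hω : (QuadraticAlgebra.omega : L) ^ 2 = algebraMap ℚ L (d : ℚ) := by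
    have h := QuadraticAlgebra.omega_mul_omega_eq_add (a := (d : ℚ)) (b := (0 : ℚ))
    rw [zero_smul, add_zero] at h
    rw [sq, h, Algebra.algebraMap_eq_smul_one]
  have hωK : (QuadraticAlgebra.omega : L) ∉ Set.range (algebraMap ℚ L) := by
    rintro ⟨r, h⟩
    have him := congrArg QuadraticAlgebra.im h
    rw [QuadraticAlgebra.omega_im] at him
    have : (algebraMap ℚ L r).im = 0 := by
      rw [show algebraMap ℚ L r = (r : L) from rfl]
      rfl
    rw [this] at him
    exact zero_ne_one him
  refine ⟨L, inferInstance, inferInstance, QuadraticAlgebra.omega, h2L, ?_, hωK⟩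
  rw [hω, map_intCast]

/-- **A relative quadratic extension `M = K(√β)` as a number field.** For `β ∈ K` not a square there is a
number field `M ⊇ K` with `[M : K] = 2` and a square-root generator `θ`, `θ² = β`, `θ ∉ K` (Mathlib's
`QuadraticAlgebra K β 0`). [folklore] -/
theorem exists_relQuadratic_sq_eq {β : K} (hβ : ¬ IsSquare β) :
    ∃ (M : Type) (_ : Field M) (_ : NumberField M) (_ : Algebra K M) (θ : M),
      Module.finrank K M = 2 ∧ θ ^ 2 = algebraMap K M β ∧ θ ∉ Set.range (algebraMap K M) := by
  have hns : ∀ r : K, r ^ 2 ≠ β := fun r hr ↦ hβ ⟨r, by rw [← hr, sq]⟩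
  haveI : Fact (∀ r : K, r ^ 2 ≠ β + 0 * r) := ⟨fun r h ↦ hns r (by rw [h]; ring)⟩
  let L := QuadraticAlgebra K β 0
  haveI : NumberField L := NumberField.of_module_finite K L
  have h2L : Module.finrank K L = 2 := by convert QuadraticAlgebra.finrank_eq_two β (0 : K)
  have hω : (QuadraticAlgebra.omega : L) ^ 2 = algebraMap K L β := by
    have h := QuadraticAlgebra.omega_mul_omega_eq_add (a := β) (b := (0 : K))
    rw [zero_smul, add_zero] at h
    rw [sq, h, Algebra.algebraMap_eq_smul_one]
  have hωK : (QuadraticAlgebra.omega : L) ∉ Set.range (algebraMap K L) := by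
    rintro ⟨r, h⟩
    have him := congrArg QuadraticAlgebra.im h
    rw [QuadraticAlgebra.omega_im, QuadraticAlgebra.algebraMap_im] at him
    exact zero_ne_one him
  exact ⟨L, inferInstance, inferInstance, inferInstance, QuadraticAlgebra.omega, h2L, hω, hωK⟩

/-- **`β = d + √d` has `ord_v β = 1` above `p`.** With `θ₁² = d`, `ord_p d = 1`, `[K : ℚ] = 2`: at every place
`v ∋ p` of `K`, `v(d + θ₁) = v(θ₁) · v(θ₁ + 1) = exp(−1) · 1` (`θ₁ ∈ 𝔭_v`, so `θ₁ + 1` is a `v`-unit by the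
ultrametric inequality). [folklore] -/
theorem valuation_intCast_add_eq (p : ℕ) [Fact p.Prime] (h2 : Module.finrank ℚ K = 2) {d : ℤ}
    {θ₁ : K} (hθ₁ : θ₁ ^ 2 = (d : K)) (hd : padicValInt p d = 1) (v : HeightOneSpectrum (𝓞 K))
    (hv : (p : 𝓞 K) ∈ v.asIdeal) : v.valuation K ((d : K) + θ₁) = exp (2 * (-1 : ℤ) + 1) := by
  have hθv : v.valuation K θ₁ = exp (-1 : ℤ) := (ramificationIdx_eq_two_of_sq_eq_intCast p h2 hθ₁ hd v hv).2
  have hfac : (d : K) + θ₁ = θ₁ * (θ₁ + 1) := by rw [← hθ₁]; ring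
  have h1 : v.valuation K (θ₁ + 1) = 1 := by
    rw [add_comm]
    refine Valuation.map_one_add_of_lt _ ?_
    rw [hθv, ← exp_zero, exp_lt_exp]; norm_num
  rw [hfac, map_mul, h1, mul_one, hθv]
  norm_num

/-- **The twist datum in the discriminant currency.** If `[K : ℚ] = 2` with `θ₁² = d`, `θ₁ ∉ ℚ`, then
`d_K = d q²` for some `q ∈ ℚ^×` (`NumberField.exists_discr_eq_mul_sq`), so a model `Wd` of the twist
`W^{(d)}` is a model of `W^{(d_K)}` (`exists_variableChange_quadraticTwist_mul_sq`: twisting by `d q²` and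
by `d` give `ℚ`-isomorphic curves) — the hypothesis shape `hWd` of
`Literature.NumberTheory.EllipticCurves.padicValRat_shaAn_add_le_shaOrder_of_bsdpOver`. [folklore] -/
theorem exists_variableChange_quadraticTwist_discr (h2 : Module.finrank ℚ K = 2) {d : ℤ} {θ₁ : K}
    (hθ₁ : θ₁ ^ 2 = (d : K)) (hθK : θ₁ ∉ Set.range (algebraMap ℚ K))
    (W Wd : WeierstrassCurve ℚ)
    (hWd : ∃ C : WeierstrassCurve.VariableChange ℚ, C • W.quadraticTwist (d : ℚ) = Wd) :
    ∃ C : WeierstrassCurve.VariableChange ℚ, C • W.quadraticTwist (NumberField.discr K : ℚ) = Wd := by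
  obtain ⟨q, hq, hdisc⟩ :=
    NumberField.exists_discr_eq_mul_sq h2 hθK (c := (d : ℚ)) (by rw [hθ₁, map_intCast])
  obtain ⟨C₁, hC₁⟩ := W.exists_variableChange_quadraticTwist_mul_sq (d : ℚ) q hq
  obtain ⟨C, hC⟩ := hWd
  refine ⟨C * C₁⁻¹, ?_⟩
  rw [hdisc, ← hC₁, mul_smul, inv_smul_smul, hC]

end Quadratic

/-! ## The tame quartic solvent field of the route -/

section SolventField

/-- **The tame quartic solvent field `L″ = ℚ(√d)(√(d + √d))`.** For a prime `p` and `d ∈ ℤ` with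
`ord_p d = 1` there are number fields `K = ℚ(θ₁) ⊂ M = K(θ)` with `[K : ℚ] = [M : K] = 2`, `θ₁² = d`,
`θ₁ ∉ ℚ`, `θ² = β := d + θ₁ ∈ K`, `θ ∉ K`, such that EVERY place `w ∋ p` of `M` has ramification index
`e(w|p) = 4` (`p` ramifies in `K` with `√d` a uniformiser, and `β = √d (√d + 1)` is again a uniformiser, so
`M/K` ramifies above `p`); in particular `[M : ℚ] = 4` and `p` is totally ramified in `M`. For `p = 3` and
the route's `d > 0`, `3 ∥ d`, this is the field shape `L″ = ℚ(√d)(√β)` of route `TameQuarticSolvent`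
(census memo QTQ1-TATE-QUARTIC-v1 §1.3: e.g. `ℚ(√21)(√(21 + 4√21))`). [folklore] -/
theorem exists_solventField (p : ℕ) [Fact p.Prime] {d : ℤ} (hd : padicValInt p d = 1) :
    ∃ (K : Type) (_ : Field K) (_ : NumberField K) (θ₁ : K)
      (M : Type) (_ : Field M) (_ : NumberField M) (_ : Algebra K M) (θ : M),
      Module.finrank ℚ K = 2 ∧ θ₁ ^ 2 = (d : K) ∧ θ₁ ∉ Set.range (algebraMap ℚ K) ∧
      Module.finrank K M = 2 ∧ θ ^ 2 = algebraMap K M ((d : K) + θ₁) ∧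
      θ ∉ Set.range (algebraMap K M) ∧
      (∀ v : HeightOneSpectrum (𝓞 K), (p : 𝓞 K) ∈ v.asIdeal →
        v.asIdeal.ramificationIdx ℤ = 2 ∧ v.valuation K ((d : K) + θ₁) = exp (2 * (-1 : ℤ) + 1)) ∧
      ∀ w : HeightOneSpectrum (𝓞 M), (p : 𝓞 M) ∈ w.asIdeal → w.asIdeal.ramificationIdx ℤ = 4 := by
  obtain ⟨K, _, _, θ₁, h2, hθ₁, hθK⟩ :=
    exists_quadraticField_sq_eq_intCast (not_isSquare_ratCast_of_padicValInt_eq_one p hd)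
  have hK : ∀ v : HeightOneSpectrum (𝓞 K), (p : 𝓞 K) ∈ v.asIdeal →
      v.asIdeal.ramificationIdx ℤ = 2 ∧ v.valuation K ((d : K) + θ₁) = exp (2 * (-1 : ℤ) + 1) :=
    fun v hv ↦ ⟨(ramificationIdx_eq_two_of_sq_eq_intCast p h2 hθ₁ hd v hv).1,
      valuation_intCast_add_eq p h2 hθ₁ hd v hv⟩
  -- a place of `K` above `p` exists (`p` is not a unit of `𝓞 K`), so `β` is not a square
  have hβ : ¬ IsSquare ((d : K) + θ₁) := by
    have hpZ : (p : ℤ) ≠ 0 := Int.natCast_ne_zero.mpr (Fact.out : p.Prime).ne_zero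
    haveI hmax : (Ideal.span {(p : ℤ)}).IsMaximal :=
      ((Ideal.span_singleton_prime hpZ).mpr (Nat.prime_iff_prime_int.mp Fact.out)).isMaximal
        (by simpa using hpZ)
    obtain ⟨𝔪, h𝔪, hover⟩ := Ideal.exists_ideal_over_maximal_of_isIntegral (S := 𝓞 K)
      (Ideal.span {(p : ℤ)}) (fun x hx ↦ by
        rw [RingHom.mem_ker, eq_intCast, Int.cast_eq_zero] at hx
        simp [hx])
    have hp𝔪 : (p : 𝓞 K) ∈ 𝔪 := by
      have : (p : ℤ) ∈ 𝔪.comap (algebraMap ℤ (𝓞 K)) := by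
        rw [hover]; exact Ideal.mem_span_singleton_self _
      simpa [Ideal.mem_comap] using this
    have h𝔪0 : 𝔪 ≠ ⊥ := by
      intro h; rw [h, Ideal.mem_bot] at hp𝔪; exact (NeZero.ne (p : 𝓞 K)) hp𝔪
    let v : HeightOneSpectrum (𝓞 K) := ⟨𝔪, h𝔪.isPrime, h𝔪0⟩
    exact not_isSquare_of_valuation_eq_exp v (hK v hp𝔪).2
  obtain ⟨M, _, _, _, θ, h2', hθ, hθM⟩ := exists_relQuadratic_sq_eq hβ
  refine ⟨K, inferInstance, inferInstance, θ₁, M, inferInstance, inferInstance, inferInstance, θ,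
    h2, hθ₁, hθK, h2', hθ, hθM, hK, fun w hw ↦ ?_⟩
  have h := ramificationIdx_int_eq_of_sq_eq (K := K) (M := M) p h2' hθ (e₀ := 2)
    (fun v hv ↦ ⟨(hK v hv).1, -1, (hK v hv).2⟩) w hw
  simpa using h

/-- **The lever over the solvent field.** A globally minimal elliptic curve over `ℚ`, additive at `3` of
census class (t′), acquires GOOD reduction at every place above `3` of any `M = K(√β)` with `[K : ℚ] = 2`,
`θ₁² = d`, `ord₃ d = 1`, `[M : K] = 2`, `θ² = β` and `β` of odd valuation at the places of `K` above `3`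
(e.g. `β = d + √d`, `valuation_intCast_add_eq`): such places have `e(w|3) = 4`
(`ramificationIdx_int_eq_of_sq_eq`), and the landed stub `stub_goodReduction` applies. [folklore] -/
theorem hasGoodReductionAt_baseChange_of_sq_eq (W : WeierstrassCurve ℚ) [W.IsElliptic]
    [W.IsGloballyMinimal] (hadd : Addv W 3) (hsub : Summit.BirchSwinnertonDyer.Rank1Residual.Additive.SubTprime W 3)
    {K M : Type} [Field K] [NumberField K] [Field M] [NumberField M] [Algebra K M]
    (h2 : Module.finrank ℚ K = 2) {d : ℤ} {θ₁ : K} (hθ₁ : θ₁ ^ 2 = (d : K)) (hd : padicValInt 3 d = 1)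
    (h2' : Module.finrank K M = 2) {β : K} {θ : M} (hθ : θ ^ 2 = algebraMap K M β)
    (hβ : ∀ v : HeightOneSpectrum (𝓞 K), ((3 : ℕ) : 𝓞 K) ∈ v.asIdeal →
      ∃ k : ℤ, v.valuation K β = exp (2 * k + 1))
    (w : HeightOneSpectrum (𝓞 M)) (hw : ((3 : ℕ) : 𝓞 M) ∈ w.asIdeal) :
    (W.baseChange M).HasGoodReductionAt w := by
  haveI : Fact (Nat.Prime 3) := ⟨Nat.prime_three⟩
  have he : w.asIdeal.ramificationIdx ℤ = 4 := by
    have h := ramificationIdx_int_eq_of_sq_eq (K := K) (M := M) 3 h2' hθ (e₀ := 2)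
      (fun v hv ↦ ⟨(ramificationIdx_eq_two_of_sq_eq_intCast 3 h2 hθ₁ hd v hv).1, hβ v hv⟩) w hw
    simpa using h
  exact stub_goodReduction W hadd hsub M w hw he

/-- **The lever over the route's field `L″ = ℚ(√d)(√(d + √d))`, packaged.** For `d ∈ ℤ` with `ord₃ d = 1`
there are number fields `K = ℚ(θ₁) ⊂ M = K(θ)`, `[K : ℚ] = [M : K] = 2`, `θ₁² = d`, `θ₁ ∉ ℚ`,
`θ² = d + θ₁`, `θ ∉ K`, every place `w ∋ 3` of `M` having `e(w|3) = 4`, over which EVERY globally minimal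
`W/ℚ` additive of class (t′) at `3` has good reduction at every place above `3` (`exists_solventField` and
`stub_goodReduction`). This is the field-theoretic input of stub `stub_pairGivenGoodField` of the birth
skeleton (the twist datum `(d, Wd)` enters through `exists_variableChange_quadraticTwist_discr`).
[folklore] -/
theorem exists_solventField_hasGoodReductionAt {d : ℤ} (hd : padicValInt 3 d = 1) :
    ∃ (K : Type) (_ : Field K) (_ : NumberField K) (θ₁ : K)
      (M : Type) (_ : Field M) (_ : NumberField M) (_ : Algebra K M) (θ : M),
      Module.finrank ℚ K = 2 ∧ θ₁ ^ 2 = (d : K) ∧ θ₁ ∉ Set.range (algebraMap ℚ K) ∧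
      Module.finrank K M = 2 ∧ θ ^ 2 = algebraMap K M ((d : K) + θ₁) ∧
      θ ∉ Set.range (algebraMap K M) ∧
      (∀ w : HeightOneSpectrum (𝓞 M), ((3 : ℕ) : 𝓞 M) ∈ w.asIdeal → w.asIdeal.ramificationIdx ℤ = 4) ∧
      ∀ (W : WeierstrassCurve ℚ) [W.IsElliptic] [W.IsGloballyMinimal], Addv W 3 →
        Summit.BirchSwinnertonDyer.Rank1Residual.Additive.SubTprime W 3 →
        ∀ w : HeightOneSpectrum (𝓞 M), ((3 : ℕ) : 𝓞 M) ∈ w.asIdeal →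
          (W.baseChange M).HasGoodReductionAt w := by
  haveI : Fact (Nat.Prime 3) := ⟨Nat.prime_three⟩
  obtain ⟨K, _, _, θ₁, M, _, _, _, θ, h2, hθ₁, hθK, h2', hθ, hθM, -, hM⟩ := exists_solventField 3 hd
  exact ⟨K, inferInstance, inferInstance, θ₁, M, inferInstance, inferInstance, inferInstance, θ, h2, hθ₁,
    hθK, h2', hθ, hθM, hM, fun W _ _ hadd hsub w hw ↦ stub_goodReduction W hadd hsub M w hw (hM w hw)⟩

end SolventField

end Summit.BirchSwinnertonDyer.BirchSwinnertonDyer.Theorems.SolventPairLowerBound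

end
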